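import Literature.NumberTheory.LFunctions.XiHigherDerivativesCriticalStrip
import Literature.NumberTheory.LFunctions.XiDerivativeCriticalZerosRolle
import HarnessLib

/-!
# Critical zeros of `ξ^{(m)}` for every `m`: finiteness of the boxes, Rolle transfer
# `N₀ˢ(T) ≤ N^{(m)}₀(T) + m`, hence `N^{(m)}₀(T) ≥ (2/3 − ε) N(T)`; under RH `κ′_m = 1`

RH-FREE (the last section consists of implications `RiemannHypothesis → …`; nothing is assumed).
Nothing here bears on the truth of RH. Topic `Literature/NumberTheory/LFunctions`; PROOF LAYER for the
general-`m` counting functions `xiDerivZeroCount m`, `xiDerivCriticalZeroCount m`,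
`xiDerivCriticalLineProportion m` of `XiDerivativeZeros.lean` (J. B. Conrey, J. Number Theory 16 (1983)
49–74, key `Conrey1983`). The tree had all of the following for `m = 1` only
(`XiDerivativeZerosCounting.lean`, `XiDerivativeCriticalZerosRolle.lean`); with Conrey's Lemma 2 (first
statement) now proved for every `m` (`Conrey1983_lemma2_strip`, `XiHigherDerivativesCriticalStrip.lean`)
the same arguments run for every `m`:

* `XiDerivCritical.xiDerivZeroBox_finite` — the zeros of `ξ^{(m)}` with `0 < Im s ≤ T` form a finite set
  (they lie in the compact rectangle `[0,1] × [0,T]`, and `ξ^{(m)} ≢ 0`), so `N^{(m)}(T)`, `N^{(m)}₀(T)`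
  are genuine finite sums; `xiDerivCriticalZeroCount_le` (`N^{(m)}₀ ≤ N^{(m)}`).
* `XiDerivCritical.exists_iteratedDeriv_succ_critical_zero_between` — Rolle on the critical line:
  between two zeros of `ξ^{(m)}` on `Re s = ½` lies a zero of `ξ^{(m+1)}` on `Re s = ½`
  (`Ξ^{(m)}(t) = i^m ξ^{(m)}(½ + it)` is real for real `t`).
* `XiDerivCritical.ncard_criticalBox_le_succ`, `…_le_add` — counted: the distinct critical zeros of
  `ξ^{(m)}` up to height `T` number at most (those of `ξ^{(m+1)}`) `+ 1`, hence the distinct critical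
  zeros of `ξ` number at most (those of `ξ^{(m)}`) `+ m`.
* **`simpleCriticalZeroCount_le_xiDerivCriticalZeroCount_add`** — `N₀ˢ(T) ≤ N^{(m)}₀(T) + m`, and with
  [AF26] Theorem A (i) (kernel theorem `AlpogeFurman2026_simple_critical_holds`):
  **`eventually_two_thirds_mul_zetaZeroCount_le_xiDerivCriticalZeroCount_higher`** — for every `m`
  and `ε > 0`, `(2/3 − ε) N(T) ≤ N^{(m)}₀(T)` for all large `T`: unconditionally at least
  `(2/3 − ε) N(T)` zeros of EVERY `ξ^{(m)}` lie on the critical line below height `T`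
  (main-term form `…_main_…`); `tendsto_xiDerivCriticalZeroCount_atTop`, `tendsto_xiDerivZeroCount_atTop`
  (`N^{(m)}₀, N^{(m)} → ∞`), `le_xiDerivCriticalLineProportion_of_eventually_le`.
* RH-CONDITIONAL implications: `xiDerivCriticalZeroCount_eq_of_RH` (`N^{(m)}₀ = N^{(m)}`) and
  **`xiDerivCriticalLineProportion_eq_one_of_RH`** (`κ′_m = 1` for every `m`).

What is NOT proved here: Conrey's Lemma 2 counting part `N^{(m)}(T) = N(T) + O_m(log T)` for `m ≥ 2`
(the tree has `m = 1`, `XiDerivativeZeroCountingFunction.lean`), hence no unconditional lower bound for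
the PROPORTION `κ′_m`, `m ≥ 2`; Conrey's records `κ′_m ≥ 0.8137, 0.9584, …` (Levinson's method) stay out of
reach. AI-produced formalisation (literature-prover-rh-lit-frontier-1-g12-0, 2026-08-27); AI review is
weaker than expert review. No endorsement of any preprint is implied ([AF26] enters only through kernel
theorems of the tree).

## References

* J. B. Conrey, J. Number Theory 16 (1983) 49–74: §1 (p. 49), Lemma 2 (p. 52). [key `Conrey1983`]
* L. Alpöge, A. Furman, arXiv:2608.13637v2, Theorem A (i) and Remark 7.1. [key `AlpogeFurman2026`]
* E. C. Titchmarsh, *The Theory of the Riemann Zeta-Function*, 2nd ed., §10.1. [key `Titchmarsh1986`]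
-/

noncomputable section

open Complex Filter Set Topology
open scoped ComplexConjugate

namespace Literature.NumberTheory.LFunctions

open Literature.Analysis.Complex

namespace XiDerivCritical

/-! ## The zeros of `ξ^{(m)}`: analyticity, multiplicities, finiteness of the boxes -/

/-- `ξ^{(m)}` is analytic everywhere. [cite: Conrey1983, Lemma 2 proof (p. 52)] -/
theorem analyticOnNhd_iteratedDeriv_riemannXi (m : ℕ) :
    AnalyticOnNhd ℂ (iteratedDeriv m riemannXi) univ :=
  (differentiable_iteratedDeriv_of_entire differentiable_riemannXi m).differentiableOn.analyticOnNhd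
    isOpen_univ

/-- `ξ^{(m)}(2) ≠ 0` (Lemma 2: no zeros with `Re s ≥ 1`). [cite: Conrey1983, Lemma 2 (p. 52)] -/
theorem iteratedDeriv_riemannXi_two_ne_zero (m : ℕ) : iteratedDeriv m riemannXi 2 ≠ 0 :=
  iteratedDeriv_riemannXi_ne_zero_of_one_le_re m (by norm_num)

/-- The zero set of `ξ^{(m)}` is closed and discrete. [cite: Conrey1983, Lemma 2 (p. 52)] -/
theorem isClosed_and_isDiscrete_zeros (m : ℕ) :
    IsClosed {s : ℂ | iteratedDeriv m riemannXi s = 0} ∧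
      IsDiscrete {s : ℂ | iteratedDeriv m riemannXi s = 0} :=
  compl_mem_codiscrete_iff.1 ((analyticOnNhd_iteratedDeriv_riemannXi m).preimage_zero_mem_codiscrete
    (x := 2) (iteratedDeriv_riemannXi_two_ne_zero m))

/-- The multiplicity of `ξ^{(m)}` at any point is finite. [cite: Conrey1983, Lemma 2 (p. 52)] -/
theorem analyticOrderAt_ne_top (m : ℕ) (s : ℂ) :
    analyticOrderAt (iteratedDeriv m riemannXi) s ≠ ⊤ := by
  intro h
  have hzero := (AnalyticOnNhd.analyticOrderAt_eq_top_iff_eq_zero s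
    (fun z ↦ analyticOnNhd_iteratedDeriv_riemannXi m z trivial)).1 h
  exact iteratedDeriv_riemannXi_two_ne_zero m (by rw [hzero]; rfl)

/-- At a zero of `ξ^{(m)}` the multiplicity is `≥ 1`. [cite: Conrey1983, Lemma 2 (p. 52)] -/
theorem one_le_analyticOrderAt_toNat (m : ℕ) {s : ℂ} (hs : iteratedDeriv m riemannXi s = 0) :
    1 ≤ (analyticOrderAt (iteratedDeriv m riemannXi) s).toNat := by
  have hne := analyticOrderAt_ne_top m s
  have hpos : analyticOrderAt (iteratedDeriv m riemannXi) s ≠ 0 := by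
    rw [ne_eq, (analyticOnNhd_iteratedDeriv_riemannXi m s trivial).analyticOrderAt_eq_zero]
    exact not_not.2 hs
  obtain ⟨n, hn⟩ := ENat.ne_top_iff_exists.1 hne
  rw [← hn, ENat.toNat_coe]
  have : n ≠ 0 := by
    rintro rfl
    exact hpos (by rw [← hn]; rfl)
  omega

/-- **The zeros of `ξ^{(m)}` with `0 < Im s ≤ T` form a finite set** (inside the compact rectangle
`[0,1] × [0,T]` by Lemma 2; the zero set is discrete). [cite: Conrey1983, Lemma 2 (p. 52)] -/
theorem xiDerivZeroBox_finite (m : ℕ) (T : ℝ) : (xiDerivZeroBox m T).Finite := by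
  obtain ⟨hcl, hdisc⟩ := isClosed_and_isDiscrete_zeros m
  have hK : IsCompact (Icc (0 : ℝ) 1 ×ℂ Icc (0 : ℝ) T) := isCompact_Icc.reProdIm isCompact_Icc
  have hfin : (Icc (0 : ℝ) 1 ×ℂ Icc (0 : ℝ) T ∩ {s : ℂ | iteratedDeriv m riemannXi s = 0}).Finite :=
    (hK.inter_right hcl).finite (hdisc.mono Set.inter_subset_right)
  refine hfin.subset ?_
  rintro s ⟨hs, him0, himT⟩
  obtain ⟨h0, h1⟩ := Conrey1983_lemma2_strip m hs
  exact ⟨Complex.mem_reProdIm.2 ⟨⟨h0.le, h1.le⟩, ⟨him0.le, himT⟩⟩, hs⟩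

/-- The critical zeros in the box form a finite set. [cite: Conrey1983, §1 (p. 49)] -/
theorem criticalBox_finite (m : ℕ) (T : ℝ) : {s ∈ xiDerivZeroBox m T | s.re = 1 / 2}.Finite :=
  (xiDerivZeroBox_finite m T).subset (sep_subset _ _)

/-- A set of critical zeros of `ξ^{(m)}` up to height `T`, each listed once, has at most `N^{(m)}₀(T)`
elements (the multiplicities are `≥ 1`). [cite: Conrey1983, §1 (p. 49)] -/
theorem ncard_le_xiDerivCriticalZeroCount (m : ℕ) {T : ℝ} {S : Set ℂ}
    (hS : S ⊆ {s ∈ xiDerivZeroBox m T | s.re = 1 / 2}) : S.ncard ≤ xiDerivCriticalZeroCount m T := by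
  classical
  have hC := criticalBox_finite m T
  unfold xiDerivCriticalZeroCount
  rw [finsum_mem_eq_finite_toFinset_sum _ hC]
  calc S.ncard ≤ {s ∈ xiDerivZeroBox m T | s.re = 1 / 2}.ncard := Set.ncard_le_ncard hS hC
    _ = hC.toFinset.card := Set.ncard_eq_toFinset_card _ hC
    _ = ∑ _s ∈ hC.toFinset, 1 := by simp
    _ ≤ ∑ s ∈ hC.toFinset, (analyticOrderAt (iteratedDeriv m riemannXi) s).toNat :=
      Finset.sum_le_sum fun s hs ↦ by
        rw [Set.Finite.mem_toFinset] at hs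
        exact one_le_analyticOrderAt_toNat m hs.1.1

end XiDerivCritical

open XiDerivCritical

/-- `N^{(m)}₀(T) ≤ N^{(m)}(T)`. [cite: Conrey1983, §1 (p. 49)] -/
theorem xiDerivCriticalZeroCount_le (m : ℕ) (T : ℝ) :
    xiDerivCriticalZeroCount m T ≤ xiDerivZeroCount m T := by
  unfold xiDerivCriticalZeroCount xiDerivZeroCount
  rw [finsum_mem_eq_finite_toFinset_sum _ (criticalBox_finite m T),
    finsum_mem_eq_finite_toFinset_sum _ (xiDerivZeroBox_finite m T)]
  exact Finset.sum_le_sum_of_subset ((Set.Finite.toFinset_subset_toFinset).2 (sep_subset _ _))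

/-- `N^{(m)}(T)` is non-decreasing in `T`. [cite: Conrey1983, Lemma 2 (p. 52)] -/
theorem xiDerivZeroCount_mono (m : ℕ) : Monotone (xiDerivZeroCount m) := by
  intro T T' h
  unfold xiDerivZeroCount
  rw [finsum_mem_eq_finite_toFinset_sum _ (xiDerivZeroBox_finite m T),
    finsum_mem_eq_finite_toFinset_sum _ (xiDerivZeroBox_finite m T')]
  exact Finset.sum_le_sum_of_subset
    ((Set.Finite.toFinset_subset_toFinset).2 (xiDerivZeroBox_mono m h))

/-- `N^{(m)}₀(T)` is non-decreasing in `T`. [cite: Conrey1983, §1 (p. 49)] -/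
theorem xiDerivCriticalZeroCount_mono (m : ℕ) : Monotone (xiDerivCriticalZeroCount m) := by
  intro T T' h
  unfold xiDerivCriticalZeroCount
  rw [finsum_mem_eq_finite_toFinset_sum _ (criticalBox_finite m T),
    finsum_mem_eq_finite_toFinset_sum _ (criticalBox_finite m T')]
  exact Finset.sum_le_sum_of_subset
    ((Set.Finite.toFinset_subset_toFinset).2 fun s ⟨hs, hre⟩ ↦ ⟨xiDerivZeroBox_mono m h hs, hre⟩)

namespace XiDerivCritical

/-! ## Rolle's theorem on the critical line, for every `m` -/

/-- **Rolle on the critical line.** If `ξ^{(m)}` vanishes at `½ + ia` and `½ + ib` (`a < b`), then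
`ξ^{(m+1)}` vanishes at some `½ + ic`, `a < c < b`: the function `t ↦ Ξ^{(m)}(t) = i^m ξ^{(m)}(½ + it)` is
real-valued and differentiable on `ℝ` with derivative `Ξ^{(m+1)}(t)`. [cite: Conrey1983, §1 (p. 49)] -/
theorem exists_iteratedDeriv_succ_critical_zero_between (m : ℕ) {a b : ℝ} (hab : a < b)
    (ha : iteratedDeriv m riemannXi (1 / 2 + a * I) = 0)
    (hb : iteratedDeriv m riemannXi (1 / 2 + b * I) = 0) :
    ∃ c ∈ Ioo a b, iteratedDeriv (m + 1) riemannXi (1 / 2 + c * I) = 0 := by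
  set F : ℂ → ℂ := iteratedDeriv m riemannXiUpper with hF
  have hFd : Differentiable ℂ F :=
    differentiable_iteratedDeriv_of_entire XiDerivStrip.differentiable_xiUpper m
  have hreal : ∀ x : ℝ, (F x).im = 0 :=
    im_iteratedDeriv_ofReal XiDerivStrip.differentiable_xiUpper im_riemannXiUpper_ofReal_holds m
  have hreal' : ∀ x : ℝ, (deriv F x).im = 0 := im_deriv_ofReal hFd hreal
  have hFt : ∀ t : ℝ, F t = I ^ m * iteratedDeriv m riemannXi (1 / 2 + t * I) := fun t ↦ by
    rw [hF, iteratedDeriv_riemannXiUpper, mul_comm I (t : ℂ)]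
  have hF't : ∀ t : ℝ, deriv F t = I ^ (m + 1) * iteratedDeriv (m + 1) riemannXi (1 / 2 + t * I) :=
    fun t ↦ by rw [hF, ← iteratedDeriv_succ, iteratedDeriv_riemannXiUpper, mul_comm I (t : ℂ)]
  set g : ℝ → ℝ := fun t ↦ (F t).re with hg
  have hgd : ∀ t : ℝ, HasDerivAt g ((deriv F t).re) t := fun t ↦
    (hFd (t : ℂ)).hasDerivAt.real_of_complex
  have hga : g a = 0 := by simp only [hg, hFt, ha, mul_zero, Complex.zero_re]
  have hgb : g b = 0 := by simp only [hg, hFt, hb, mul_zero, Complex.zero_re]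
  obtain ⟨c, hc, hc0⟩ := exists_hasDerivAt_eq_zero hab
    (fun t _ ↦ (hgd t).continuousAt.continuousWithinAt) (hga.trans hgb.symm) fun t _ ↦ hgd t
  refine ⟨c, hc, ?_⟩
  have hzero : deriv F c = 0 := Complex.ext (by simpa using hc0) (by simpa using hreal' c)
  rw [hF't] at hzero
  exact (mul_eq_zero.1 hzero).resolve_left (pow_ne_zero _ I_ne_zero)

/-- **Rolle transfer, counted: the distinct critical zeros of `ξ^{(m)}` with ordinates in `(0, T]`
number at most one more than those of `ξ^{(m+1)}`** (sort the ordinates, apply Rolle between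
consecutive ones; the Rolle points are distinct). [cite: Conrey1983, §1 (p. 49)] -/
theorem ncard_criticalBox_le_succ (m : ℕ) (T : ℝ) :
    {s ∈ xiDerivZeroBox m T | s.re = 1 / 2}.ncard ≤
      {s ∈ xiDerivZeroBox (m + 1) T | s.re = 1 / 2}.ncard + 1 := by
  classical
  set C : Set ℂ := {s ∈ xiDerivZeroBox m T | s.re = 1 / 2} with hC
  have hCfin : C.Finite := criticalBox_finite m T
  have hinjOn : InjOn Complex.im C := by
    intro ρ hρ ρ' hρ' h
    exact Complex.ext (by rw [hρ.2, hρ'.2]) h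
  set tF : Finset ℝ := hCfin.toFinset.image Complex.im with htF
  set k : ℕ := tF.card with hk
  have hcardC : C.ncard = k := by
    rw [hk, htF, Finset.card_image_of_injOn (by
      intro ρ hρ ρ' hρ' h
      exact hinjOn ((Set.Finite.mem_toFinset hCfin).1 hρ)
        ((Set.Finite.mem_toFinset hCfin).1 hρ') h), Set.ncard_eq_toFinset_card C hCfin]
  rw [hcardC]
  have hmem : ∀ u ∈ tF, iteratedDeriv m riemannXi (1 / 2 + (u : ℂ) * I) = 0 ∧ 0 < u ∧ u ≤ T := by
    intro u hu
    rw [htF, Finset.mem_image] at hu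
    obtain ⟨ρ, hρ, rfl⟩ := hu
    rw [Set.Finite.mem_toFinset] at hρ
    have hρeq : (1 / 2 : ℂ) + (ρ.im : ℂ) * I = ρ := by
      apply Complex.ext <;> simp [hρ.2]
    rw [hρeq]
    exact ⟨hρ.1.1, hρ.1.2.1, hρ.1.2.2⟩
  set t : Fin k ↪o ℝ := tF.orderEmbOfFin hk.symm with ht
  have htmem : ∀ j : Fin k, t j ∈ tF := fun j ↦ by
    rw [ht]
    exact Finset.orderEmbOfFin_mem tF hk.symm j
  have htmono : StrictMono t := t.strictMono
  rcases Nat.lt_or_ge k 2 with hk2 | hk2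
  · omega
  have hrolle : ∀ j : Fin (k - 1), ∃ c : ℝ,
      t ⟨j.1, by omega⟩ < c ∧ c < t ⟨j.1 + 1, by omega⟩ ∧
        iteratedDeriv (m + 1) riemannXi (1 / 2 + (c : ℂ) * I) = 0 := by
    intro j
    have hlt : t ⟨j.1, by omega⟩ < t ⟨j.1 + 1, by omega⟩ :=
      htmono (Fin.mk_lt_mk.2 (Nat.lt_succ_self _))
    obtain ⟨c, hc, hc0⟩ := exists_iteratedDeriv_succ_critical_zero_between m hlt
      (hmem _ (htmem _)).1 (hmem _ (htmem _)).1
    exact ⟨c, hc.1, hc.2, hc0⟩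
  choose c hc_lo hc_hi hc_zero using hrolle
  have hcmono : StrictMono c := by
    intro i j hij
    have hij' : i.1 < j.1 := hij
    calc c i < t ⟨i.1 + 1, by omega⟩ := hc_hi i
      _ ≤ t ⟨j.1, by omega⟩ := htmono.monotone (Fin.mk_le_mk.2 (by omega))
      _ < c j := hc_lo j
  set S : Set ℂ := Set.range fun j : Fin (k - 1) ↦ (1 / 2 : ℂ) + (c j : ℂ) * I with hS
  have hinj : Function.Injective fun j : Fin (k - 1) ↦ (1 / 2 : ℂ) + (c j : ℂ) * I := by
    intro i j hij
    have him := congrArg Complex.im hij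
    simp only [add_im, mul_im, ofReal_re, I_im, mul_one, ofReal_im, I_re, mul_zero, add_zero] at him
    have h12 : ((1 / 2 : ℂ)).im = 0 := by norm_num
    rw [h12, zero_add, zero_add] at him
    exact hcmono.injective him
  have hSncard : S.ncard = k - 1 := by
    rw [hS, Set.ncard_range_of_injective hinj, Nat.card_eq_fintype_card, Fintype.card_fin]
  have hSsub : S ⊆ {s ∈ xiDerivZeroBox (m + 1) T | s.re = 1 / 2} := by
    rintro s ⟨j, rfl⟩
    have him : ((1 / 2 : ℂ) + (c j : ℂ) * I).im = c j := by simp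
    have hre : ((1 / 2 : ℂ) + (c j : ℂ) * I).re = 1 / 2 := by simp
    have hpos : 0 < c j := by
      have h0 : 0 < t ⟨j.1, by omega⟩ := (hmem _ (htmem _)).2.1
      linarith [hc_lo j]
    have hle : c j ≤ T := by
      have h1 : t ⟨j.1 + 1, by omega⟩ ≤ T := (hmem _ (htmem _)).2.2
      linarith [hc_hi j]
    refine ⟨⟨hc_zero j, ?_, ?_⟩, hre⟩
    · rw [him]; exact hpos
    · rw [him]; exact hle
  have hle := Set.ncard_le_ncard hSsub (criticalBox_finite (m + 1) T)
  rw [hSncard] at hle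
  omega

/-- Iterated: the distinct critical zeros of `ξ` with ordinates in `(0, T]` number at most those of
`ξ^{(m)}` plus `m`. [cite: Conrey1983, §1 (p. 49)] -/
theorem ncard_criticalBox_zero_le_add (m : ℕ) (T : ℝ) :
    {s ∈ xiDerivZeroBox 0 T | s.re = 1 / 2}.ncard ≤
      {s ∈ xiDerivZeroBox m T | s.re = 1 / 2}.ncard + m := by
  induction m with
  | zero => simp
  | succ m ih =>
    have := ncard_criticalBox_le_succ m T
    omega

/-- The zeros of `ζ` on the critical segment `0 < Im ρ ≤ T` are critical zeros of `ξ = ξ^{(0)}` in the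
box (the zeros of `ξ` are the zeros of `ζ` in the open strip). [cite: Titchmarsh1986, §2.12] -/
theorem zeta_criticalZeros_subset (T : ℝ) :
    {ρ ∈ zetaZeroBox (1 / 2) T | ρ.re = 1 / 2} ⊆ {s ∈ xiDerivZeroBox 0 T | s.re = 1 / 2} := by
  rintro ρ ⟨⟨hζ, -, -, him0, himT⟩, hre⟩
  refine ⟨⟨?_, him0, himT⟩, hre⟩
  rw [iteratedDeriv_zero]
  exact (riemannXi_eq_zero_iff_holds ρ).2 ⟨hζ, by rw [hre]; norm_num, by rw [hre]; norm_num⟩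

end XiDerivCritical

/-! ## `N₀ˢ(T) ≤ N^{(m)}₀(T) + m` and `(2/3 − ε) N(T) ≤ N^{(m)}₀(T)` for every `m` -/

/-- **`N₀ˢ(T) ≤ N^{(m)}₀(T) + m` for every `m`**: the simple zeros of `ζ` on the critical line with
`0 < Im ρ ≤ T` number at most `m` more than the zeros of `ξ^{(m)}` on the critical line up to height `T`
(counted with multiplicity) — `m`-fold Rolle. The case `m = 1` is
`simpleCriticalZeroCount_le_xiDerivCriticalZeroCount_add_one`. [cite: Conrey1983, §1 (p. 49)] -/
theorem simpleCriticalZeroCount_le_xiDerivCriticalZeroCount_add (m : ℕ) (T : ℝ) :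
    simpleCriticalZeroCount T ≤ xiDerivCriticalZeroCount m T + m := by
  have hsub : {ρ ∈ zetaZeroBox (1 / 2) T | ρ.re = 1 / 2 ∧ riemannZetaZeroOrder ρ = 1} ⊆
      {ρ ∈ zetaZeroBox (1 / 2) T | ρ.re = 1 / 2} := fun ρ hρ ↦ ⟨hρ.1, hρ.2.1⟩
  calc simpleCriticalZeroCount T
      ≤ {ρ ∈ zetaZeroBox (1 / 2) T | ρ.re = 1 / 2}.ncard :=
        Set.ncard_le_ncard hsub (criticalZeroSet_finite T)
    _ ≤ {s ∈ xiDerivZeroBox 0 T | s.re = 1 / 2}.ncard :=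
        Set.ncard_le_ncard (zeta_criticalZeros_subset T) (criticalBox_finite 0 T)
    _ ≤ {s ∈ xiDerivZeroBox m T | s.re = 1 / 2}.ncard + m := ncard_criticalBox_zero_le_add m T
    _ ≤ xiDerivCriticalZeroCount m T + m := by
        have := ncard_le_xiDerivCriticalZeroCount m (subset_refl {s ∈ xiDerivZeroBox m T | s.re = 1 / 2})
        omega

/-- **Unconditionally, for every `m`, at least `(2/3 − ε) N(T)` zeros of `ξ^{(m)}` lie on the critical
line below height `T`**: for every `ε > 0` and all sufficiently large `T`,
`(2/3 − ε) N(T) ≤ N^{(m)}₀(T)` ([AF26] Theorem A (i), cumulative form — the tree's kernel theorem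
`AlpogeFurman2026_simple_critical_holds`: `(2/3 − ε/2) N(T) ≤ N₀ˢ(T)` eventually; `m`-fold Rolle:
`N₀ˢ(T) ≤ N^{(m)}₀(T) + m`; and `(ε/2) N(T) ≥ m` eventually). Conrey's proportions
(`κ′₁ ≥ 0.8137`, `κ′₂ ≥ 0.9584`, …, Levinson's method) are NOT proved here.
[cite: AlpogeFurman2026, Theorem A (i) (p. 1) and Remark 7.1] [cite: Conrey1983, §1 (p. 49)] -/
theorem eventually_two_thirds_mul_zetaZeroCount_le_xiDerivCriticalZeroCount_higher (m : ℕ) (ε : ℝ)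
    (hε : 0 < ε) :
    ∀ᶠ T : ℝ in atTop, (2 / 3 - ε) * (zetaZeroCount T : ℝ) ≤ xiDerivCriticalZeroCount m T := by
  have hAF := AlpogeFurman2026_simple_critical_holds (ε / 2) (by positivity)
  have hN : Tendsto zetaZeroCount atTop atTop := tendsto_zetaZeroCount_atTop_holds
  obtain ⟨M, hM⟩ := exists_nat_gt (2 * m / ε)
  have hbig : ∀ᶠ T : ℝ in atTop, M ≤ zetaZeroCount T := hN.eventually (eventually_ge_atTop M)
  filter_upwards [hAF, hbig] with T hT hMT
  have hR : (simpleCriticalZeroCount T : ℝ) ≤ (xiDerivCriticalZeroCount m T : ℝ) + m := by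
    exact_mod_cast simpleCriticalZeroCount_le_xiDerivCriticalZeroCount_add m T
  have hMT' : (M : ℝ) ≤ zetaZeroCount T := by exact_mod_cast hMT
  have hm : (m : ℝ) ≤ ε / 2 * (zetaZeroCount T : ℝ) := by
    have h2 : 2 * m / ε < zetaZeroCount T := hM.trans_le hMT'
    rw [div_lt_iff₀ hε] at h2
    linarith
  linarith

/-- Main-term form: for every `m`, `ε > 0` and all large `T`, `(2/3 − ε)(T/2π) log T ≤ N^{(m)}₀(T)`.
[cite: AlpogeFurman2026, Theorem A (i) (p. 1) and Remark 7.1] [cite: Titchmarsh1986, Thm. 9.4] -/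
theorem eventually_two_thirds_mul_main_le_xiDerivCriticalZeroCount_higher (m : ℕ) (ε : ℝ)
    (hε : 0 < ε) :
    ∀ᶠ T : ℝ in atTop,
      (2 / 3 - ε) * (T / (2 * Real.pi) * Real.log T) ≤ xiDerivCriticalZeroCount m T := by
  rcases le_or_gt (2 / 3 : ℝ) ε with hbig | hsmall
  · filter_upwards [eventually_gt_atTop (1 : ℝ)] with T hT
    have hM : 0 ≤ T / (2 * Real.pi) * Real.log T := by
      have := Real.log_pos hT
      positivity
    have h0 : (0 : ℝ) ≤ xiDerivCriticalZeroCount m T := Nat.cast_nonneg _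
    nlinarith
  have h1 := eventually_two_thirds_mul_zetaZeroCount_le_xiDerivCriticalZeroCount_higher m (ε / 2)
    (by positivity)
  have h2 := AlpogeFurman2026.eventually_zetaZeroCount_near_main (ε / 2) (by positivity)
  filter_upwards [h1, h2, eventually_gt_atTop (1 : ℝ)] with T hT hNT hT1
  have hM : 0 ≤ T / (2 * Real.pi) * Real.log T := by
    have := Real.log_pos hT1
    positivity
  have hlow := hNT.1
  have hc : 0 ≤ 2 / 3 - ε / 2 := by linarith
  calc (2 / 3 - ε) * (T / (2 * Real.pi) * Real.log T)
      ≤ (2 / 3 - ε / 2) * ((1 - ε / 2) * (T / (2 * Real.pi) * Real.log T)) := by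
        nlinarith [mul_nonneg hε.le hM, mul_nonneg (mul_nonneg hε.le hε.le) hM]
    _ ≤ (2 / 3 - ε / 2) * (zetaZeroCount T : ℝ) := mul_le_mul_of_nonneg_left hlow hc
    _ ≤ xiDerivCriticalZeroCount m T := hT

/-- **`N^{(m)}₀(T) → ∞`** for every `m` (indeed `≥ (1/3) N(T)` eventually). [cite: Conrey1983, §1 (p. 49)] -/
theorem tendsto_xiDerivCriticalZeroCount_atTop (m : ℕ) :
    Tendsto (xiDerivCriticalZeroCount m) atTop atTop := by
  have h := eventually_two_thirds_mul_zetaZeroCount_le_xiDerivCriticalZeroCount_higher m (1 / 3)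
    (by norm_num)
  have hN : Tendsto zetaZeroCount atTop atTop := tendsto_zetaZeroCount_atTop_holds
  refine tendsto_atTop.2 fun b ↦ ?_
  filter_upwards [h, hN.eventually (eventually_ge_atTop (3 * b))] with T hT hNb
  have hNb' : ((3 * b : ℕ) : ℝ) ≤ zetaZeroCount T := by exact_mod_cast hNb
  push_cast at hNb'
  have : (b : ℝ) ≤ xiDerivCriticalZeroCount m T := by linarith
  exact_mod_cast this

/-- **`N^{(m)}(T) → ∞`** for every `m`. [cite: Conrey1983, Lemma 2 (p. 52)] -/
theorem tendsto_xiDerivZeroCount_atTop (m : ℕ) : Tendsto (xiDerivZeroCount m) atTop atTop :=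
  tendsto_atTop_mono (xiDerivCriticalZeroCount_le m) (tendsto_xiDerivCriticalZeroCount_atTop m)

/-- **From a per-`T` proportion to `κ′_m`**: if `c · N^{(m)}(T) ≤ N^{(m)}₀(T)` for all large `T`, then
`c ≤ κ′_m = liminf N^{(m)}₀/N^{(m)}` (the ratio is `≤ 1`, and `N^{(m)}(T) > 0` for large `T`).
[cite: Conrey1983, §1 (p. 49): definition of the proportion] -/
theorem le_xiDerivCriticalLineProportion_of_eventually_le (m : ℕ) {c : ℝ}
    (h : ∀ᶠ T : ℝ in atTop, c * (xiDerivZeroCount m T : ℝ) ≤ xiDerivCriticalZeroCount m T) :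
    c ≤ xiDerivCriticalLineProportion m := by
  have hle : ∀ T : ℝ, (xiDerivCriticalZeroCount m T : ℝ) / xiDerivZeroCount m T ≤ 1 := fun T ↦ by
    rcases Nat.eq_zero_or_pos (xiDerivZeroCount m T) with h0 | hpos
    · simp [h0]
    · rw [div_le_one (by exact_mod_cast hpos)]
      exact_mod_cast xiDerivCriticalZeroCount_le m T
  unfold xiDerivCriticalLineProportion
  refine le_liminf_of_le (isCoboundedUnder_ge_of_le atTop (x := 1) hle) ?_
  filter_upwards [h, (tendsto_xiDerivZeroCount_atTop m).eventually_gt_atTop 0] with T hT hN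
  rw [le_div_iff₀ (by exact_mod_cast hN)]
  exact hT

/-- `0 ≤ κ′_m ≤ 1`. [cite: Conrey1983, §1 (p. 49)] -/
theorem xiDerivCriticalLineProportion_mem_Icc (m : ℕ) :
    xiDerivCriticalLineProportion m ∈ Icc (0 : ℝ) 1 := by
  have hle : ∀ T : ℝ, (xiDerivCriticalZeroCount m T : ℝ) / xiDerivZeroCount m T ≤ 1 := fun T ↦ by
    rcases Nat.eq_zero_or_pos (xiDerivZeroCount m T) with h0 | hpos
    · simp [h0]
    · rw [div_le_one (by exact_mod_cast hpos)]
      exact_mod_cast xiDerivCriticalZeroCount_le m T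
  have hge : ∀ T : ℝ, 0 ≤ (xiDerivCriticalZeroCount m T : ℝ) / xiDerivZeroCount m T := fun T ↦ by
    positivity
  constructor
  · exact le_xiDerivCriticalLineProportion_of_eventually_le m
      (Eventually.of_forall fun T ↦ by simp)
  · unfold xiDerivCriticalLineProportion
    exact liminf_le_of_frequently_le (Eventually.of_forall hle).frequently
      (isBoundedUnder_of ⟨0, fun T ↦ hge T⟩)

/-! ## Under RH: `N^{(m)}₀ = N^{(m)}` and `κ′_m = 1` for every `m` (RH-CONDITIONAL implications) -/

/-- RH-CONDITIONAL. Under RH every zero of `ξ^{(m)}` is on the critical line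
(`riemannHypothesis_imp_iteratedDeriv_riemannXi_zeros_on_line`), so `N^{(m)}₀(T) = N^{(m)}(T)`.
[cite: Conrey1983, §1 (p. 49)] -/
theorem xiDerivCriticalZeroCount_eq_of_RH (hRH : RiemannHypothesis) (m : ℕ) (T : ℝ) :
    xiDerivCriticalZeroCount m T = xiDerivZeroCount m T := by
  have hset : {s ∈ xiDerivZeroBox m T | s.re = 1 / 2} = xiDerivZeroBox m T := by
    ext s
    exact ⟨fun h ↦ h.1,
      fun h ↦ ⟨h, riemannHypothesis_imp_iteratedDeriv_riemannXi_zeros_on_line hRH m h.1⟩⟩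
  unfold xiDerivCriticalZeroCount xiDerivZeroCount
  rw [hset]

/-- RH-CONDITIONAL. **Under RH, `κ′_m = 1` for every `m`.** [cite: Conrey1983, §1 (p. 49)] -/
theorem xiDerivCriticalLineProportion_eq_one_of_RH (hRH : RiemannHypothesis) (m : ℕ) :
    xiDerivCriticalLineProportion m = 1 := by
  unfold xiDerivCriticalLineProportion
  have hev : ∀ᶠ T : ℝ in atTop,
      (xiDerivCriticalZeroCount m T : ℝ) / xiDerivZeroCount m T = (fun _ : ℝ ↦ (1 : ℝ)) T := by
    filter_upwards [(tendsto_xiDerivZeroCount_atTop m).eventually_gt_atTop 0] with T hT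
    rw [xiDerivCriticalZeroCount_eq_of_RH hRH]
    exact div_self (by exact_mod_cast hT.ne')
  rw [liminf_congr hev, liminf_const]

end Literature.NumberTheory.LFunctions

end
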